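import Summits.Ventures.CertifiedManyBodySolver.Downfold.EmeryGammaOffsetCertA
import HarnessLib

/-!
# The certificate of the Γ-OFFSET SLOPE LEVER (s = 0 end of the fixed-harmonic lever WITHOUT the t_pp ≤ |t_pd| atom: regime t_ppΔ ≤ 4t_pd² only), part B (parts 20–23 of a 632-term integer-weight Handelman-form polynomial; kernel-checked `positivity`)

Venture CertifiedManyBodySolver, cell `pub/hubbard-downfold` (stage S1; INFLATION-RULES-3to1-B §B.75), seat hubbard-downfold-mod-4 (technique B, g30); namespace
`Summit.Ventures.CertifiedManyBodySolver.Downfold.Emery`. Object: `gammaOffsetCert Δ ε₁ d c h m Q` (assembled in the last part): 632 products `λ·Δ^i ε₁^j d^k c^l h^n m^r·{1, atoms, degree ≤ 2}` with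
positive INTEGER weights (`L = 4`); atoms `Q = 4t_pd² − t_ppΔ`; variables as in `EmeryFermiScaleFaceCCertA` (`c = t_pp′`, `h = t_pp − t_pp′`, `m = t_pd² − t_pp′ε₂`, `d = ε₂ − ε₁`). FOUND by linear
programming (kit jobs of this seat: Handelman basis of degree ≤ 2, unit-monomial columns explicit, exact repair) and CHECKED here by `positivity` (parts) and in the sequel by `ring` (identity) —
nothing trusts the search. Everything PROVED (0 sorry). WHAT THIS IS NOT: a statement about any material; an object with physical meaning by itself.

Sources: polynomial positivity certificates on semialgebraic sets [folklore] (Handelman, Pacific J. Math. 132 (1988) 35–62).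
-/

noncomputable section

namespace Summit.Ventures.CertifiedManyBodySolver.Downfold.Emery

open Real Set

/-- Part 20 of the certificate polynomial `gammaOffsetCert` (30 positively weighted products, integer weights). [folklore] -/
def gammaOffsetCertP20 (Δ ε₁ d c h m _Q : ℝ) : ℝ :=
  512 * Δ ^ 3 * c ^ 3 * m ^ 2 + 48 * Δ ^ 3 * c ^ 3 * h ^ 2 * m + 20 * Δ ^ 3 * c ^ 5 * m + 16 * Δ ^ 3 * d * m ^ 3 + 320 * Δ ^ 3 * d * c * h * m ^ 2 +
  896 * Δ ^ 3 * d * c ^ 2 * m ^ 2 + 208 * Δ ^ 3 * d * c ^ 3 * h * m + 8 * Δ ^ 3 * d * c ^ 3 * h ^ 3 + 1024 * Δ ^ 3 * d * c ^ 4 * m +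
  20 * Δ ^ 3 * d * c ^ 6 + 48 * Δ ^ 3 * d ^ 2 * c * m ^ 2 + 16 * Δ ^ 3 * d ^ 2 * c * h ^ 2 * m + 448 * Δ ^ 3 * d ^ 2 * c ^ 2 * h * m +
  960 * Δ ^ 3 * d ^ 2 * c ^ 3 * m + 16 * Δ ^ 3 * d ^ 2 * c ^ 3 * h ^ 2 + 160 * Δ ^ 3 * d ^ 2 * c ^ 4 * h + 512 * Δ ^ 3 * d ^ 2 * c ^ 5 +
  44 * Δ ^ 3 * d ^ 3 * c ^ 2 * m + 16 * Δ ^ 3 * d ^ 3 * c ^ 2 * h ^ 2 + 192 * Δ ^ 3 * d ^ 3 * c ^ 3 * h + 320 * Δ ^ 3 * d ^ 3 * c ^ 4 +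
  12 * Δ ^ 3 * d ^ 4 * c ^ 3 + 32 * Δ ^ 3 * ε₁ * m ^ 3 + 384 * Δ ^ 3 * ε₁ * c * h * m ^ 2 + 1024 * Δ ^ 3 * ε₁ * c ^ 2 * m ^ 2 +
  160 * Δ ^ 3 * ε₁ * c ^ 2 * h ^ 2 * m + 464 * Δ ^ 3 * ε₁ * c ^ 3 * h * m + 1024 * Δ ^ 3 * ε₁ * c ^ 4 * m + 8 * Δ ^ 3 * ε₁ * c ^ 5 * h +
  20 * Δ ^ 3 * ε₁ * c ^ 6

/-- `gammaOffsetCertP20 ≥ 0` for non-negative arguments. [folklore] -/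
theorem gammaOffsetCertP20_nonneg {Δ ε₁ d c h m Q : ℝ} (hΔ : 0 ≤ Δ) (h1 : 0 ≤ ε₁) (hd : 0 ≤ d) (hc : 0 ≤ c) (hh : 0 ≤ h) (hm : 0 ≤ m) :
    0 ≤ gammaOffsetCertP20 Δ ε₁ d c h m Q := by
  unfold gammaOffsetCertP20
  positivity

/-- Part 21 of the certificate polynomial `gammaOffsetCert` (30 positively weighted products, integer weights). [folklore] -/
def gammaOffsetCertP21 (Δ ε₁ d c h m _Q : ℝ) : ℝ :=
  160 * Δ ^ 3 * ε₁ * d * c * m ^ 2 + 64 * Δ ^ 3 * ε₁ * d * c * h ^ 2 * m + 1024 * Δ ^ 3 * ε₁ * d * c ^ 2 * h * m + 2048 * Δ ^ 3 * ε₁ * d * c ^ 3 * m +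
  192 * Δ ^ 3 * ε₁ * d * c ^ 3 * h ^ 2 + 576 * Δ ^ 3 * ε₁ * d * c ^ 4 * h + 1024 * Δ ^ 3 * ε₁ * d * c ^ 5 + 192 * Δ ^ 3 * ε₁ * d ^ 2 * c ^ 2 * m +
  80 * Δ ^ 3 * ε₁ * d ^ 2 * c ^ 2 * h ^ 2 + 640 * Δ ^ 3 * ε₁ * d ^ 2 * c ^ 3 * h + 960 * Δ ^ 3 * ε₁ * d ^ 2 * c ^ 4 + 60 * Δ ^ 3 * ε₁ * d ^ 3 * c ^ 3 +
  112 * Δ ^ 3 * ε₁ ^ 2 * c * m ^ 2 + 64 * Δ ^ 3 * ε₁ ^ 2 * c * h ^ 2 * m + 576 * Δ ^ 3 * ε₁ ^ 2 * c ^ 2 * h * m + 1024 * Δ ^ 3 * ε₁ ^ 2 * c ^ 3 * m +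
  176 * Δ ^ 3 * ε₁ ^ 2 * c ^ 3 * h ^ 2 + 416 * Δ ^ 3 * ε₁ ^ 2 * c ^ 4 * h + 512 * Δ ^ 3 * ε₁ ^ 2 * c ^ 5 + 232 * Δ ^ 3 * ε₁ ^ 2 * d * c ^ 2 * m +
  128 * Δ ^ 3 * ε₁ ^ 2 * d * c ^ 2 * h ^ 2 + 704 * Δ ^ 3 * ε₁ ^ 2 * d * c ^ 3 * h + 896 * Δ ^ 3 * ε₁ ^ 2 * d * c ^ 4 +
  88 * Δ ^ 3 * ε₁ ^ 2 * d ^ 2 * c ^ 3 + 80 * Δ ^ 3 * ε₁ ^ 3 * c ^ 2 * m + 64 * Δ ^ 3 * ε₁ ^ 3 * c ^ 2 * h ^ 2 + 256 * Δ ^ 3 * ε₁ ^ 3 * c ^ 3 * h +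
  256 * Δ ^ 3 * ε₁ ^ 3 * c ^ 4 + 40 * Δ ^ 3 * ε₁ ^ 3 * d * c ^ 3 + 8 * Δ ^ 4 * m ^ 3

/-- `gammaOffsetCertP21 ≥ 0` for non-negative arguments. [folklore] -/
theorem gammaOffsetCertP21_nonneg {Δ ε₁ d c h m Q : ℝ} (hΔ : 0 ≤ Δ) (h1 : 0 ≤ ε₁) (hd : 0 ≤ d) (hc : 0 ≤ c) (hh : 0 ≤ h) (hm : 0 ≤ m) :
    0 ≤ gammaOffsetCertP21 Δ ε₁ d c h m Q := by
  unfold gammaOffsetCertP21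
  positivity

/-- Part 22 of the certificate polynomial `gammaOffsetCert` (30 positively weighted products, integer weights). [folklore] -/
def gammaOffsetCertP22 (Δ ε₁ d c h m _Q : ℝ) : ℝ :=
  48 * Δ ^ 4 * c * h * m ^ 2 + 128 * Δ ^ 4 * c ^ 2 * m ^ 2 + 1 * Δ ^ 4 * c ^ 2 * h ^ 4 + 24 * Δ ^ 4 * c ^ 3 * h * m + 1 * Δ ^ 4 * c ^ 5 * h +
  36 * Δ ^ 4 * d * c * m ^ 2 + 96 * Δ ^ 4 * d * c ^ 2 * h * m + 224 * Δ ^ 4 * d * c ^ 3 * m + 24 * Δ ^ 4 * d * c ^ 4 * h +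
  40 * Δ ^ 4 * d ^ 2 * c ^ 2 * m + 48 * Δ ^ 4 * d ^ 2 * c ^ 3 * h + 96 * Δ ^ 4 * d ^ 2 * c ^ 4 + 12 * Δ ^ 4 * d ^ 3 * c ^ 3 +
  48 * Δ ^ 4 * ε₁ * c * m ^ 2 + 16 * Δ ^ 4 * ε₁ * c * h ^ 2 * m + 112 * Δ ^ 4 * ε₁ * c ^ 2 * h * m + 4 * Δ ^ 4 * ε₁ * c ^ 2 * h ^ 3 +
  192 * Δ ^ 4 * ε₁ * c ^ 3 * m + 4 * Δ ^ 4 * ε₁ * c ^ 3 * h ^ 2 + 24 * Δ ^ 4 * ε₁ * c ^ 4 * h + 88 * Δ ^ 4 * ε₁ * d * c ^ 2 * m +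
  16 * Δ ^ 4 * ε₁ * d * c ^ 2 * h ^ 2 + 112 * Δ ^ 4 * ε₁ * d * c ^ 3 * h + 160 * Δ ^ 4 * ε₁ * d * c ^ 4 + 32 * Δ ^ 4 * ε₁ * d ^ 2 * c ^ 3 +
  40 * Δ ^ 4 * ε₁ ^ 2 * c ^ 2 * m + 16 * Δ ^ 4 * ε₁ ^ 2 * c ^ 2 * h ^ 2 + 64 * Δ ^ 4 * ε₁ ^ 2 * c ^ 3 * h + 64 * Δ ^ 4 * ε₁ ^ 2 * c ^ 4 +
  20 * Δ ^ 4 * ε₁ ^ 2 * d * c ^ 3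

/-- `gammaOffsetCertP22 ≥ 0` for non-negative arguments. [folklore] -/
theorem gammaOffsetCertP22_nonneg {Δ ε₁ d c h m Q : ℝ} (h1 : 0 ≤ ε₁) (hd : 0 ≤ d) (hc : 0 ≤ c) (hh : 0 ≤ h) (hm : 0 ≤ m) :
    0 ≤ gammaOffsetCertP22 Δ ε₁ d c h m Q := by
  unfold gammaOffsetCertP22
  positivity

/-- Part 23 of the certificate polynomial `gammaOffsetCert` (7 positively weighted products, integer weights). [folklore] -/
def gammaOffsetCertP23 (Δ ε₁ d c h m _Q : ℝ) : ℝ :=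
  2 * Δ ^ 5 * h ^ 5 + 8 * Δ ^ 5 * c * m ^ 2 + 2 * Δ ^ 5 * c ^ 3 * h ^ 2 + 12 * Δ ^ 5 * d * c ^ 2 * m + 4 * Δ ^ 5 * d ^ 2 * c ^ 3 +
  8 * Δ ^ 5 * ε₁ * c ^ 2 * m + 4 * Δ ^ 5 * ε₁ * d * c ^ 3

/-- `gammaOffsetCertP23 ≥ 0` for non-negative arguments. [folklore] -/
theorem gammaOffsetCertP23_nonneg {Δ ε₁ d c h m Q : ℝ} (hΔ : 0 ≤ Δ) (h1 : 0 ≤ ε₁) (hd : 0 ≤ d) (hc : 0 ≤ c) (hh : 0 ≤ h) (hm : 0 ≤ m) :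
    0 ≤ gammaOffsetCertP23 Δ ε₁ d c h m Q := by
  unfold gammaOffsetCertP23
  positivity

/-- **The certificate polynomial `gammaOffsetCert`** (632 products with positive INTEGER weights, `L = 4`; atoms Q; strict term `48·Δ ^ 2 * ε₁ ^ 2 * m ^ 3` first; 23 parts). [folklore] -/
def gammaOffsetCert (Δ ε₁ d c h m Q : ℝ) : ℝ :=
  48 * Δ ^ 2 * ε₁ ^ 2 * m ^ 3 +
    gammaOffsetCertP1 Δ ε₁ d c h m Q +
    gammaOffsetCertP2 Δ ε₁ d c h m Q +
    gammaOffsetCertP3 Δ ε₁ d c h m Q +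
    gammaOffsetCertP4 Δ ε₁ d c h m Q +
    gammaOffsetCertP5 Δ ε₁ d c h m Q +
    gammaOffsetCertP6 Δ ε₁ d c h m Q +
    gammaOffsetCertP7 Δ ε₁ d c h m Q +
    gammaOffsetCertP8 Δ ε₁ d c h m Q +
    gammaOffsetCertP9 Δ ε₁ d c h m Q +
    gammaOffsetCertP10 Δ ε₁ d c h m Q +
    gammaOffsetCertP11 Δ ε₁ d c h m Q +
    gammaOffsetCertP12 Δ ε₁ d c h m Q +
    gammaOffsetCertP13 Δ ε₁ d c h m Q +
    gammaOffsetCertP14 Δ ε₁ d c h m Q +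
    gammaOffsetCertP15 Δ ε₁ d c h m Q +
    gammaOffsetCertP16 Δ ε₁ d c h m Q +
    gammaOffsetCertP17 Δ ε₁ d c h m Q +
    gammaOffsetCertP18 Δ ε₁ d c h m Q +
    gammaOffsetCertP19 Δ ε₁ d c h m Q +
    gammaOffsetCertP20 Δ ε₁ d c h m Q +
    gammaOffsetCertP21 Δ ε₁ d c h m Q +
    gammaOffsetCertP22 Δ ε₁ d c h m Q +
    gammaOffsetCertP23 Δ ε₁ d c h m Q

/-- `gammaOffsetCert > 0` for `Δ, ε₁, m > 0` and all other arguments `≥ 0`. [folklore] -/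
theorem gammaOffsetCert_pos {Δ ε₁ d c h m Q : ℝ} (hΔ : 0 < Δ) (h1 : 0 < ε₁) (hd : 0 ≤ d) (hc : 0 ≤ c) (hh : 0 ≤ h) (hm : 0 < m) (hQ : 0 ≤ Q) :
    0 < gammaOffsetCert Δ ε₁ d c h m Q := by
  have p1 : 0 ≤ gammaOffsetCertP1 Δ ε₁ d c h m Q := gammaOffsetCertP1_nonneg (hΔ := hΔ.le) (h1 := h1.le) (hd := hd) (hc := hc) (hh := hh) (hm := hm.le) (hQ := hQ)
  have p2 : 0 ≤ gammaOffsetCertP2 Δ ε₁ d c h m Q := gammaOffsetCertP2_nonneg (hΔ := hΔ.le) (h1 := h1.le) (hd := hd) (hc := hc) (hh := hh) (hm := hm.le) (hQ := hQ)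
  have p3 : 0 ≤ gammaOffsetCertP3 Δ ε₁ d c h m Q := gammaOffsetCertP3_nonneg (hΔ := hΔ.le) (h1 := h1.le) (hc := hc) (hh := hh) (hm := hm.le)
  have p4 : 0 ≤ gammaOffsetCertP4 Δ ε₁ d c h m Q := gammaOffsetCertP4_nonneg (hd := hd) (hc := hc) (hh := hh) (hm := hm.le)
  have p5 : 0 ≤ gammaOffsetCertP5 Δ ε₁ d c h m Q := gammaOffsetCertP5_nonneg (h1 := h1.le) (hd := hd) (hc := hc) (hh := hh) (hm := hm.le)
  have p6 : 0 ≤ gammaOffsetCertP6 Δ ε₁ d c h m Q := gammaOffsetCertP6_nonneg (h1 := h1.le) (hd := hd) (hc := hc) (hh := hh) (hm := hm.le)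
  have p7 : 0 ≤ gammaOffsetCertP7 Δ ε₁ d c h m Q := gammaOffsetCertP7_nonneg (hd := hd) (hc := hc) (hh := hh) (hm := hm.le)
  have p8 : 0 ≤ gammaOffsetCertP8 Δ ε₁ d c h m Q := gammaOffsetCertP8_nonneg (h1 := h1.le) (hd := hd) (hc := hc) (hh := hh) (hm := hm.le)
  have p9 : 0 ≤ gammaOffsetCertP9 Δ ε₁ d c h m Q := gammaOffsetCertP9_nonneg (h1 := h1.le) (hd := hd) (hc := hc) (hh := hh) (hm := hm.le)
  have p10 : 0 ≤ gammaOffsetCertP10 Δ ε₁ d c h m Q := gammaOffsetCertP10_nonneg (h1 := h1.le) (hd := hd) (hc := hc) (hh := hh) (hm := hm.le)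
  have p11 : 0 ≤ gammaOffsetCertP11 Δ ε₁ d c h m Q := gammaOffsetCertP11_nonneg (hΔ := hΔ.le) (h1 := h1.le) (hd := hd) (hc := hc) (hh := hh) (hm := hm.le)
  have p12 : 0 ≤ gammaOffsetCertP12 Δ ε₁ d c h m Q := gammaOffsetCertP12_nonneg (hΔ := hΔ.le) (h1 := h1.le) (hd := hd) (hc := hc) (hh := hh) (hm := hm.le)
  have p13 : 0 ≤ gammaOffsetCertP13 Δ ε₁ d c h m Q := gammaOffsetCertP13_nonneg (hΔ := hΔ.le) (h1 := h1.le) (hd := hd) (hc := hc) (hh := hh) (hm := hm.le)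
  have p14 : 0 ≤ gammaOffsetCertP14 Δ ε₁ d c h m Q := gammaOffsetCertP14_nonneg (hΔ := hΔ.le) (hd := hd) (hc := hc) (hh := hh) (hm := hm.le)
  have p15 : 0 ≤ gammaOffsetCertP15 Δ ε₁ d c h m Q := gammaOffsetCertP15_nonneg (hΔ := hΔ.le) (h1 := h1.le) (hd := hd) (hc := hc) (hh := hh) (hm := hm.le)
  have p16 : 0 ≤ gammaOffsetCertP16 Δ ε₁ d c h m Q := gammaOffsetCertP16_nonneg (hΔ := hΔ.le) (h1 := h1.le) (hd := hd) (hc := hc) (hh := hh) (hm := hm.le)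
  have p17 : 0 ≤ gammaOffsetCertP17 Δ ε₁ d c h m Q := gammaOffsetCertP17_nonneg (h1 := h1.le) (hd := hd) (hc := hc) (hh := hh) (hm := hm.le)
  have p18 : 0 ≤ gammaOffsetCertP18 Δ ε₁ d c h m Q := gammaOffsetCertP18_nonneg (h1 := h1.le) (hd := hd) (hc := hc) (hh := hh) (hm := hm.le)
  have p19 : 0 ≤ gammaOffsetCertP19 Δ ε₁ d c h m Q := gammaOffsetCertP19_nonneg (hΔ := hΔ.le) (h1 := h1.le) (hd := hd) (hc := hc) (hh := hh) (hm := hm.le)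
  have p20 : 0 ≤ gammaOffsetCertP20 Δ ε₁ d c h m Q := gammaOffsetCertP20_nonneg (hΔ := hΔ.le) (h1 := h1.le) (hd := hd) (hc := hc) (hh := hh) (hm := hm.le)
  have p21 : 0 ≤ gammaOffsetCertP21 Δ ε₁ d c h m Q := gammaOffsetCertP21_nonneg (hΔ := hΔ.le) (h1 := h1.le) (hd := hd) (hc := hc) (hh := hh) (hm := hm.le)
  have p22 : 0 ≤ gammaOffsetCertP22 Δ ε₁ d c h m Q := gammaOffsetCertP22_nonneg (h1 := h1.le) (hd := hd) (hc := hc) (hh := hh) (hm := hm.le)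
  have p23 : 0 ≤ gammaOffsetCertP23 Δ ε₁ d c h m Q := gammaOffsetCertP23_nonneg (hΔ := hΔ.le) (h1 := h1.le) (hd := hd) (hc := hc) (hh := hh) (hm := hm.le)
  have hs : 0 < (48 : ℝ) * Δ ^ 2 * ε₁ ^ 2 * m ^ 3 := by positivity
  unfold gammaOffsetCert
  linarith

end Summit.Ventures.CertifiedManyBodySolver.Downfold.Emery
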